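import Summits.Ventures.HodgeRepro2.T5BergmanKernel

/-!
# Schur orthogonality for the lowest-weight vector against every vector of the model

For `h` in the weighted Bergman space `A_k` (`k ≥ 2`) the matrix coefficient of the lowest-weight
vector `1` against `h`,

  `c_h(g) = ⟨π_k(g) 1, h⟩_k = a^{-k} · π/(k-1) · conj h(g·0)`   (`g = su11 a b`, `coeffLowest_eq`),

is explicit through the reproducing kernel (`T5BergmanKernel.act_lowest_eq_kernel` + `pairing_kernel`), so
`|c_h(g)|² = (π/(k-1))² (1 - |g·0|²)^k |h(g·0)|²` (`norm_coeffLowest_sq`) — a function of `g·0` alone.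
Integrating over `SU(1,1)` through the fibration theorem (`T5SU11FibrationHaar.integral_eq`):

  `∫_G |⟨π_k(g) 1, h⟩_k|² dμ_R = ‖1‖² ‖h‖² / (k-1)`   (`integral_norm_coeffLowest_sq_ruhl`),

**Schur orthogonality with the formal degree `d(π_k) = k - 1 = 2 k_R - 1`** against Rühl's measure
`μ_R = ν/π`, now for the PAIR `(1, h)` with `h ∈ A_k` ARBITRARY (the §24 statement
`T5BergmanCoefficientL2.integral_norm_coeff_sq_ruhl` is the case `k = 3`, `h = 1`); the coefficient is
`μ`-integrable for every Haar measure `μ` (`integrable_norm_coeffLowest_sq`).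

Blind lane: Mathlib + the HodgeRepro2 prefix only; no sorry; axioms ⊆ {propext, Classical.choice,
Quot.sound}.
-/

namespace Summit.Ventures.HodgeRepro2.T5BergmanSchur

open MeasureTheory MeasureTheory.Measure Metric Filter Topology
open T5PoincareMeasure T5SU11Unimodular T5SU11Fibration T5SU11FibrationHaar T5SU11FibrationCartan
  T5HaarCircle T5SU11CoefficientL2
open T5BergmanCoefficient T5BergmanPairing T5BergmanUnitary T5BergmanCoefficientL2 T5BergmanParseval
  T5BergmanFourier T5BergmanKernel
open scoped ENNReal NNReal Real

/-! ### The coefficient -/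

/-- The matrix coefficient of the lowest-weight vector against `h`: `g ↦ ⟨π_k(g) 1, h⟩_k`. -/
noncomputable def coeffLowest (k : ℕ) (h : ℂ → ℂ) (g : SU11) : ℂ := pairing k (act k g lowest) h

/-- **The coefficient through the kernel**: `⟨π_k(g) 1, h⟩_k = a^{-k} · π/(k-1) · conj h(g·0)` for
`h ∈ A_k`, `g = su11 a b`. -/
theorem coeffLowest_eq (k : ℕ) (hk : 2 ≤ k) (b : ℕ → ℂ) (h : ℂ → ℂ)
    (hh : ∀ w ∈ ball (0 : ℂ) 1, HasSum (fun m => b m * w ^ m) (h w))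
    (hint : IntegrableOn (fun w => ‖h w‖ ^ 2 * (1 - ‖w‖ ^ 2) ^ (k - 2)) (ball (0 : ℂ) 1)) (g : SU11) :
    coeffLowest k h g =
      (mat g 0 0)⁻¹ ^ k * (((π / ((k : ℝ) - 1) : ℝ) : ℂ) * (starRingEnd ℂ) (h (orbit g))) := by
  unfold coeffLowest
  have e : ∀ w ∈ ball (0 : ℂ) 1, act k g lowest w = (mat g 0 0)⁻¹ ^ k * kernel k (orbit g) w :=
    fun w _ => act_lowest_eq_kernel k g w
  rw [pairing_congr e (fun _ _ => rfl), pairing_const_mul_left, pairing_conj_symm k h (kernel k (orbit g)),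
    pairing_kernel k hk b h hh hint (orbit_mem_ball g), map_mul, Complex.conj_ofReal]

/-- **The square of the coefficient is a function of `g·0`**:
`|⟨π_k(g) 1, h⟩_k|² = (π/(k-1))² (1 - |g·0|²)^k |h(g·0)|²`. -/
theorem norm_coeffLowest_sq (k : ℕ) (hk : 2 ≤ k) (b : ℕ → ℂ) (h : ℂ → ℂ)
    (hh : ∀ w ∈ ball (0 : ℂ) 1, HasSum (fun m => b m * w ^ m) (h w))
    (hint : IntegrableOn (fun w => ‖h w‖ ^ 2 * (1 - ‖w‖ ^ 2) ^ (k - 2)) (ball (0 : ℂ) 1)) (g : SU11) :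
    ‖coeffLowest k h g‖ ^ 2 =
      (π / ((k : ℝ) - 1)) ^ 2 * ((1 - ‖orbit g‖ ^ 2) ^ k * ‖h (orbit g)‖ ^ 2) := by
  have hk1 : (0 : ℝ) < (k : ℝ) - 1 := by
    have : (2 : ℝ) ≤ k := by exact_mod_cast hk
    linarith
  rw [coeffLowest_eq k hk b h hh hint g, norm_mul, norm_mul, norm_pow, norm_inv, Complex.norm_real,
    Real.norm_eq_abs, abs_of_pos (by positivity), Complex.norm_conj, one_sub_norm_orbit_sq]
  ring

/-! ### Integration over the group through the fibration -/

/-- The disc function `Φ(z) = (1 - |z|²)^k |h(z)|²`, against the Poincaré density: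
`dens z · Φ(z) = |h(z)|² (1 - |z|²)^{k-2}` on `𝔻`. -/
lemma dens_mul_phi (k : ℕ) (hk : 2 ≤ k) (h : ℂ → ℂ) {z : ℂ} (hz : z ∈ ball (0 : ℂ) 1) :
    dens z * ((1 - ‖z‖ ^ 2) ^ k * ‖h z‖ ^ 2) = ‖h z‖ ^ 2 * (1 - ‖z‖ ^ 2) ^ (k - 2) := by
  obtain ⟨m, rfl⟩ := Nat.exists_eq_add_of_le' hk
  rw [dens_eq_norm, show m + 2 - 2 = m by omega]
  have hne : 1 - ‖z‖ ^ 2 ≠ 0 := by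
    have := mem_ball_zero_iff.mp hz
    have h2 : ‖z‖ ^ 2 < 1 := by nlinarith [norm_nonneg z]
    linarith
  field_simp
  ring

/-- `Φ` is `poincare`-integrable for `h ∈ A_k`. -/
lemma integrable_phi_poincare (k : ℕ) (hk : 2 ≤ k) (h : ℂ → ℂ)
    (hint : IntegrableOn (fun w => ‖h w‖ ^ 2 * (1 - ‖w‖ ^ 2) ^ (k - 2)) (ball (0 : ℂ) 1)) :
    Integrable (fun z : ℂ => (1 - ‖z‖ ^ 2) ^ k * ‖h z‖ ^ 2) poincare := by
  have hd : Measurable fun z : ℂ => Real.toNNReal (dens z) := measurable_dens.real_toNNReal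
  have e : poincare = (volume.restrict (ball 0 1)).withDensity
      fun z => ((Real.toNNReal (dens z) : ℝ≥0) : ℝ≥0∞) := rfl
  rw [e, integrable_withDensity_iff_integrable_smul hd]
  refine hint.congr_fun ?_ measurableSet_ball
  intro z hz
  simp only
  rw [NNReal.smul_def, Real.coe_toNNReal _ (dens_nonneg z), smul_eq_mul, dens_mul_phi k hk h hz]

/-- `Φ(g·0)` at `g = s(z) · rot u` is `Φ(z)`. -/
lemma phi_fib (k : ℕ) (h : ℂ → ℂ) {z : ℂ} (hz : z ∈ ball (0 : ℂ) 1) (u : Circle) :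
    (1 - ‖orbit (fib (z, u))‖ ^ 2) ^ k * ‖h (orbit (fib (z, u)))‖ ^ 2 =
      (1 - ‖z‖ ^ 2) ^ k * ‖h z‖ ^ 2 := by
  rw [orbit_fib hz u]

variable [MeasurableSpace Circle] [BorelSpace Circle]

/-- **`|⟨π_k(g) 1, h⟩_k|²` is integrable against every Haar measure of `SU(1,1)`** for `h ∈ A_k`. -/
theorem integrable_norm_coeffLowest_sq (μ : Measure SU11) [IsHaarMeasure μ] (k : ℕ) (hk : 2 ≤ k)
    (b : ℕ → ℂ) (h : ℂ → ℂ)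
    (hh : ∀ w ∈ ball (0 : ℂ) 1, HasSum (fun m => b m * w ^ m) (h w))
    (hint : IntegrableOn (fun w => ‖h w‖ ^ 2 * (1 - ‖w‖ ^ 2) ^ (k - 2)) (ball (0 : ℂ) 1)) :
    Integrable (fun g => ‖coeffLowest k h g‖ ^ 2) μ := by
  set F : SU11 → ℝ := fun g => (1 - ‖orbit g‖ ^ 2) ^ k * ‖h (orbit g)‖ ^ 2 with hF
  have hcF : Continuous F := by
    have hhc : ContinuousOn h (ball 0 1) := continuousOn_ball b h hh
    have h1 : Continuous fun g : SU11 => h (orbit g) :=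
      hhc.comp_continuous continuous_orbit orbit_mem_ball
    rw [hF]
    exact ((continuous_const.sub (continuous_orbit.norm.pow 2)).pow k).mul (h1.norm.pow 2)
  have hFeq : (fun g => ‖coeffLowest k h g‖ ^ 2) = fun g => (π / ((k : ℝ) - 1)) ^ 2 * F g :=
    funext fun g => norm_coeffLowest_sq k hk b h hh hint g
  rw [hFeq]
  refine Integrable.const_mul ?_ _
  -- integrability of `F` against `μ` through `ν = c • μ` and the fibration
  set c := haarScalarFactor (nu haarCircle) μ with hc
  have hc0 : c ≠ 0 := (haarScalarFactor_cartan_pos μ).ne'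
  have hnu : nu haarCircle = c • μ := nu_eq_smul haarCircle μ
  have hmeas : AEStronglyMeasurable F (nu haarCircle) := hcF.aestronglyMeasurable
  have hint_nu : Integrable F (nu haarCircle) := by
    rw [nu, integrable_map_measure (by rw [← nu]; exact hmeas) measurable_fib.aemeasurable]
    have hae : (fun p : ℂ × Circle => (1 - ‖p.1‖ ^ 2) ^ k * ‖h p.1‖ ^ 2) =ᵐ[poincare.prod haarCircle]
        (F ∘ fib) := by
      have hnull : (poincare.prod haarCircle) ((ball (0 : ℂ) 1)ᶜ ×ˢ (Set.univ : Set Circle)) = 0 := by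
        rw [Measure.prod_prod, poincare_compl_ball, zero_mul]
      rw [Filter.EventuallyEq, ae_iff]
      apply measure_mono_null _ hnull
      intro p hp
      simp only [Set.mem_setOf_eq] at hp
      refine ⟨?_, Set.mem_univ _⟩
      intro hball
      exact hp (by
        rw [Function.comp_apply, show fib p = fib (p.1, p.2) from rfl, hF]
        simp only
        rw [phi_fib k h hball])
    exact ((integrable_phi_poincare k hk h hint).comp_fst haarCircle).congr hae
  rw [hnu] at hint_nu
  exact (integrable_smul_measure (ENNReal.coe_ne_zero.mpr hc0) ENNReal.coe_ne_top).mp hint_nu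

/-- **The integral against every Haar measure**: `c • ∫_G |⟨π_k(g) 1, h⟩_k|² dμ = (π/(k-1))² ⟨h, h⟩_k`,
`c = haarScalarFactor ν μ`. -/
theorem integral_norm_coeffLowest_sq (μ : Measure SU11) [IsHaarMeasure μ] (k : ℕ) (hk : 2 ≤ k)
    (b : ℕ → ℂ) (h : ℂ → ℂ)
    (hh : ∀ w ∈ ball (0 : ℂ) 1, HasSum (fun m => b m * w ^ m) (h w))
    (hint : IntegrableOn (fun w => ‖h w‖ ^ 2 * (1 - ‖w‖ ^ 2) ^ (k - 2)) (ball (0 : ℂ) 1)) :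
    (haarScalarFactor (nu haarCircle) μ : ℝ) • ∫ g, ‖coeffLowest k h g‖ ^ 2 ∂μ =
      (π / ((k : ℝ) - 1)) ^ 2 * (pairing k h h).re := by
  rw [integral_eq haarCircle μ _ (integrable_norm_coeffLowest_sq μ k hk b h hh hint)]
  have e : ∀ z ∈ ball (0 : ℂ) 1,
      dens z • ∫ u, ‖coeffLowest k h (sec z * rot u)‖ ^ 2 ∂haarCircle =
        (π / ((k : ℝ) - 1)) ^ 2 * (‖h z‖ ^ 2 * (1 - ‖z‖ ^ 2) ^ (k - 2)) := by
    intro z hz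
    have hin : ∀ u : Circle, ‖coeffLowest k h (sec z * rot u)‖ ^ 2 =
        (π / ((k : ℝ) - 1)) ^ 2 * ((1 - ‖z‖ ^ 2) ^ k * ‖h z‖ ^ 2) := by
      intro u
      rw [norm_coeffLowest_sq k hk b h hh hint, show sec z * rot u = fib (z, u) from rfl, phi_fib k h hz u]
    simp_rw [hin]
    rw [integral_const, measureReal_def, haarCircle_univ, ENNReal.toReal_one, one_smul, smul_eq_mul,
      mul_left_comm, dens_mul_phi k hk h hz]
  rw [setIntegral_congr_fun measurableSet_ball e, integral_const_mul, pairing_self_eq, Complex.ofReal_re]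

/-- **Schur orthogonality for the pair `(1, h)` against Rühl's measure `μ_R = ν/π`**:
`∫_G |⟨π_k(g) 1, h⟩_k|² dμ_R = ⟨1, 1⟩_k ⟨h, h⟩_k / (k - 1)` for every `h ∈ A_k` — the formal degree of
the weight-`k` model is `d = k - 1 = 2 k_R - 1` (`= 2` for `π₃⁺`). -/
theorem integral_norm_coeffLowest_sq_ruhl (k : ℕ) (hk : 2 ≤ k) (b : ℕ → ℂ) (h : ℂ → ℂ)
    (hh : ∀ w ∈ ball (0 : ℂ) 1, HasSum (fun m => b m * w ^ m) (h w))
    (hint : IntegrableOn (fun w => ‖h w‖ ^ 2 * (1 - ‖w‖ ^ 2) ^ (k - 2)) (ball (0 : ℂ) 1)) :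
    ∫ g, ‖coeffLowest k h g‖ ^ 2 ∂ruhl =
      (pairing k lowest lowest).re * (pairing k h h).re / ((k : ℝ) - 1) := by
  have hk1 : (0 : ℝ) < (k : ℝ) - 1 := by
    have : (2 : ℝ) ≤ k := by exact_mod_cast hk
    linarith
  have hν := integral_norm_coeffLowest_sq (nu haarCircle) k hk b h hh hint
  rw [haarScalarFactor_self, NNReal.coe_one, one_smul] at hν
  unfold ruhl
  rw [integral_smul_measure, ENNReal.toReal_ofReal (by positivity), smul_eq_mul, hν,
    pairing_lowest_lowest k hk, Complex.ofReal_re]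
  have hπ : π ≠ 0 := Real.pi_ne_zero
  field_simp

/-- The same for holomorphic `h ∈ A_k` (Taylor representation). -/
theorem integral_norm_coeffLowest_sq_ruhl_of_differentiableOn (k : ℕ) (hk : 2 ≤ k) (h : ℂ → ℂ)
    (hd : DifferentiableOn ℂ h (ball 0 1))
    (hint : IntegrableOn (fun w => ‖h w‖ ^ 2 * (1 - ‖w‖ ^ 2) ^ (k - 2)) (ball (0 : ℂ) 1)) :
    ∫ g, ‖coeffLowest k h g‖ ^ 2 ∂ruhl =
      (pairing k lowest lowest).re * (pairing k h h).re / ((k : ℝ) - 1) :=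
  integral_norm_coeffLowest_sq_ruhl k hk _ h (hasSum_taylor h hd) hint

end Summit.Ventures.HodgeRepro2.T5BergmanSchur
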